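import Literature.NumberTheory.GaloisCohomology.BrauerSumInvCyclicClass
import HarnessLib

/-!
# Arithmetic inputs of Tate's correction at `p`: elements with prescribed orders and congruences,
# the normalised order on `K_v` versus the adelic absolute value, solvability in `ℤ/N`
# (Tate, Cassels–Fröhlich VII §11; Neukirch, *Algebraic Number Theory* I §3 (CRT), II §3)

Small inputs of the "pre-reduction at `p`" (node T-pre of the tree's discharge of
`poitouTate_sum_localTatePairing_eq_zero`, file `BrauerClassCorrectionAtP.lean`), isolated here so
that the assembly only has to put them together:

* `ord_adicCompletion_eq_of_valued_eq` — the normalised additive valuation `ord_{K_v}` of the local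
  field `K_v` (`LocalWeilDatum.ord`, the currency of `localInvariantMap_localization_cupProduct_δ₀`)
  against the adelic absolute value: `|x|_v = exp(-e) ⇒ ord_{K_v} x = e`;
* `exists_ord_eq_and_valuation_sub_one_lt` — **an element `a ∈ Kˣ` with prescribed orders
  `ord_v(a) = e_v` at finitely many places and `a ≡ 1 (mod 𝔭_w)` at finitely many others** (Chinese
  remainder theorem in `𝓞_K`, Mathlib `IsDedekindDomain.exists_forall_sub_mem_ideal`);
* `ZMod.exists_natCast_mul_eq_of_gcd_dvd` — in `ℤ/N`, `t` is a multiple of `f` as soon as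
  `gcd(f, N) ∣ t` (Bezout).

Theorems only; no named fact (D-0026).

## References

* J. Tate, *Global class field theory*, Ch. VII of Cassels–Fröhlich (1967), §11. [CasselsFrohlichANT1967]
* J. Neukirch, *Algebraic Number Theory* (1999), I §3 (Chinese remainder theorem), II §3–§5.
  [NeukirchANT1999]
-/

noncomputable section

open Function Field NumberField IsDedekindDomain ValuativeRel
open scoped NumberField

namespace Literature.NumberTheory.GaloisCohomology

open Literature.NumberTheory.GaloisRepresentations
open Literature.NumberTheory.GaloisRepresentations.LocalWeilDatum
open Literature.NumberTheory.GaloisRepresentations.IsNonarchimedeanLocalField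

variable {K : Type} [Field K] [NumberField K]

/-! ### §1. `ord_{K_v}` against the adelic absolute value -/

/-- **`|x|_v = exp(-e) ⇒ ord_{K_v}(x) = e`**: the normalised order of the local field `K_v`
(`LocalWeilDatum.ord`, defined from the valuative relation of `K_v`) and Mathlib's adelic absolute
value `Valued.v` on `v.adicCompletion K` are equivalent valuations (`ValuativeRel.isEquiv`); a
uniformiser of `K_v` has `|ϖ|_v = exp(-1)` (`ArtinLocalGlobal.valued_eq_exp_neg_one_of_isUniformizer`).
[cite: NeukirchANT1999, Ch. II §5] -/
theorem ord_adicCompletion_eq_of_valued_eq (v : HeightOneSpectrum (𝓞 K)) {x : v.adicCompletion K}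
    (hx : x ≠ 0) {e : ℤ} (h : Valued.v x = WithZero.exp (-e)) :
    ord (v.adicCompletion K) x = e := by
  classical
  set F := v.adicCompletion K with hF
  obtain ⟨ϖ, hϖ⟩ := IsDiscreteValuationRing.exists_irreducible 𝒪[F]
  have hπ0 : (ϖ : F) ≠ 0 := fun h0 => hϖ.ne_zero (Subtype.ext h0)
  have hπ : (valuation F).IsUniformizer (ϖ : F) := (ord_eq_one_iff F hπ0).1 (ord_eq_one_of_irreducible F hϖ)
  have hvπ : Valued.v (ϖ : F) = WithZero.exp (-1 : ℤ) := ArtinLocalGlobal.valued_eq_exp_neg_one_of_isUniformizer v hπ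
  have heq := ValuativeRel.isEquiv (valuation F) (Valued.v : Valuation F (WithZero (Multiplicative ℤ)))
  rw [ord_eq_iff F hx, ← (isUniformizer_iff_valuation_eq_unifValue F (ϖ : F)).mp hπ, ← map_zpow₀,
    heq.eq_iff, map_zpow₀, hvπ, h, ← WithZero.exp_zsmul, smul_eq_mul, mul_neg, mul_one]

/-- The same for a global element: `|a|_v = exp(-e) ⇒ ord_{K_v}(a) = e`. [cite: NeukirchANT1999, Ch. II §5] -/
theorem ord_adicCompletion_algebraMap_eq_of_valuation_eq (v : HeightOneSpectrum (𝓞 K)) {a : K} (ha : a ≠ 0)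
    {e : ℤ} (h : v.valuation K a = WithZero.exp (-e)) :
    ord (v.adicCompletion K) (algebraMap K (v.adicCompletion K) a) = e :=
  ord_adicCompletion_eq_of_valued_eq v ((map_ne_zero_iff _ (algebraMap K _).injective).2 ha)
    (by rw [valued_algebraMap_adicCompletion, h])

/-! ### §2. Elements with prescribed orders and congruences (CRT) -/

/-- **An element with prescribed orders at `S` and `≡ 1` at `T`**: for disjoint finite sets `S`, `T`
of finite places of `K` and exponents `e : S → ℕ` there is `a ∈ Kˣ` with `ord_{K_v}(a) = e_v` for
`v ∈ S` and `|a - 1|_w < 1` for `w ∈ T` (Chinese remainder theorem in `𝓞_K`: `a ≡ π_v^{e_v}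
(mod 𝔭_v^{e_v + 1})`, `a ≡ 1 (mod 𝔭_w)`).  This is the auxiliary element of Tate's correction at `p`
(Cassels–Fröhlich VII §11). [cite: NeukirchANT1999, Ch. I §3 Thm. (3.6)] [cite: CasselsFrohlichANT1967, Ch. VII §11] -/
theorem exists_ord_eq_and_valuation_sub_one_lt (S T : Finset (HeightOneSpectrum (𝓞 K)))
    (hST : Disjoint S T) (e : HeightOneSpectrum (𝓞 K) → ℕ) :
    ∃ a : K, a ≠ 0 ∧
      (∀ v ∈ S, ord (v.adicCompletion K) (algebraMap K (v.adicCompletion K) a) = e v) ∧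
      (∀ w ∈ T, w.valuation K (a - 1) < 1) := by
  classical
  -- uniformisers
  have hunif : ∀ v : HeightOneSpectrum (𝓞 K), ∃ π : 𝓞 K, v.intValuation π = WithZero.exp (-1 : ℤ) :=
    fun v => v.intValuation_exists_uniformizer
  choose π hπ using hunif
  -- CRT data on `S ∪ T`
  let P : HeightOneSpectrum (𝓞 K) → Ideal (𝓞 K) := fun v => v.asIdeal
  let n : HeightOneSpectrum (𝓞 K) → ℕ := fun v => if v ∈ S then e v + 1 else 1
  let x : ↥(S ∪ T) → 𝓞 K := fun i => if (i : HeightOneSpectrum (𝓞 K)) ∈ S then π i ^ e i else 1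
  obtain ⟨y, hy⟩ := IsDedekindDomain.exists_forall_sub_mem_ideal (s := S ∪ T) P n
    (fun v _ => v.prime) (fun v _ w _ hvw h => hvw (HeightOneSpectrum.ext h)) x
  -- valuations of `y`
  have hyS : ∀ v ∈ S, v.intValuation y = WithZero.exp (-(e v : ℤ)) := by
    intro v hv
    have hmem := hy v (Finset.mem_union_left T hv)
    simp only [x, n, if_pos hv, P] at hmem
    have hπe : v.intValuation (π v ^ e v) = WithZero.exp (-(e v : ℤ)) := by
      rw [map_pow, hπ, ← WithZero.exp_nsmul]
      congr 1
      simp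
    have hdiff : v.intValuation (y - π v ^ e v) < WithZero.exp (-(e v : ℤ)) := by
      refine lt_of_le_of_lt ((v.intValuation_le_pow_iff_mem _ _).mpr hmem) ?_
      rw [WithZero.exp_lt_exp]; push_cast; omega
    have := Valuation.map_add_eq_of_lt_left (v := v.intValuation) (x := π v ^ e v) (y := y - π v ^ e v)
      (by rw [hπe]; exact hdiff)
    rwa [add_sub_cancel, hπe] at this
  have hyT : ∀ w ∈ T, w.intValuation (y - 1) < 1 := by
    intro w hw
    have hwS : w ∉ S := fun h => Finset.disjoint_left.mp hST h hw
    have hmem := hy w (Finset.mem_union_right S hw)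
    simp only [x, n, if_neg hwS, P, pow_one] at hmem
    exact (w.intValuation_lt_one_iff_mem _).mpr hmem
  -- `y ≠ 0` unless there is nothing to do
  by_cases hempty : S = ∅ ∧ T = ∅
  · refine ⟨1, one_ne_zero, fun v hv => ?_, fun w hw => ?_⟩
    · rw [hempty.1] at hv; exact absurd hv (Finset.notMem_empty v)
    · rw [hempty.2] at hw; exact absurd hw (Finset.notMem_empty w)
  have hy0 : (y : K) ≠ 0 := by
    intro h0
    have hy00 : y = 0 := by exact_mod_cast h0
    rcases not_and_or.mp hempty with hS | hT
    · obtain ⟨v, hv⟩ := Finset.nonempty_iff_ne_empty.mpr hS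
      have := hyS v hv
      rw [hy00, map_zero] at this
      exact WithZero.zero_ne_coe this
    · obtain ⟨w, hw⟩ := Finset.nonempty_iff_ne_empty.mpr hT
      have := hyT w hw
      rw [hy00, zero_sub, Valuation.map_neg, map_one] at this
      exact lt_irrefl _ this
  refine ⟨y, hy0, fun v hv => ?_, fun w hw => ?_⟩
  · exact ord_adicCompletion_algebraMap_eq_of_valuation_eq v hy0
      (by rw [HeightOneSpectrum.valuation_of_algebraMap, hyS v hv])
  · have : ((y : K) - 1) = ((y - 1 : 𝓞 K) : K) := by push_cast; ring
    rw [this, HeightOneSpectrum.valuation_of_algebraMap]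
    exact hyT w hw

/-! ### §3. Solvability of `k · f = t` in `ℤ/N` -/

/-- **In `ℤ/N`, `t` is a natural multiple of `f` as soon as `gcd(f, N) ∣ t`** (Bezout:
`gcd(f, N) = u f + w N`).  Used to match a prescribed local invariant with a multiple of the
invariant `ψ(Frob_v)·ord_v(a)` of an auxiliary cyclic class. [cite: CasselsFrohlichANT1967, Ch. VII §11] -/
theorem ZMod.exists_natCast_mul_eq_of_gcd_dvd {N : ℕ} [NeZero N] (f t : ZMod N)
    (h : Nat.gcd f.val N ∣ t.val) : ∃ k : ℕ, (k : ZMod N) * f = t := by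
  set g : ℕ := Nat.gcd f.val N with hg
  have hbez : (g : ZMod N) = f * (Nat.gcdA f.val N : ZMod N) := by
    have h1 : ((g : ℤ) : ZMod N) = ((f.val : ℤ) * Nat.gcdA f.val N + (N : ℤ) * Nat.gcdB f.val N : ℤ) := by
      rw [hg, ← Nat.gcd_eq_gcd_ab]
    push_cast at h1
    rw [ZMod.natCast_self, zero_mul, add_zero, ZMod.natCast_zmod_val] at h1
    exact_mod_cast h1
  obtain ⟨c, hc⟩ := h
  refine ⟨((c : ZMod N) * (Nat.gcdA f.val N : ZMod N)).val, ?_⟩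
  rw [ZMod.natCast_zmod_val, mul_assoc, mul_comm _ f, ← hbez, mul_comm, ← Nat.cast_mul, ← hc,
    ZMod.natCast_zmod_val]

end Literature.NumberTheory.GaloisCohomology

end
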